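import Mathlib
import HarnessLib
import Literature.NumberTheory.DiophantineGeometry.BelyiPairWronskian
import Literature.NumberTheory.DiophantineGeometry.BelyiPairReduction

/-!
# Ramification of a rational map `p/q : ℙ¹ → ℙ¹` read off the Wronskian

Topic `Literature/NumberTheory/DiophantineGeometry`; companion of `BelyiPairWronskian.lean` (the
Wronskian of a Belyi PAIR, i.e. under the root-count hypothesis `IsBelyiPair`) and
`BelyiPairReduction.lean` (`rootMultiplicity_wronskian_of_pole`, `coeff_wronskian_natDegree`).
Here the same Wronskian calculus WITHOUT any Belyi hypothesis, for an arbitrary coprime pair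
`p, q ∈ K[X]` over a field `K` of characteristic `0`, `W := p q′ − p′ q` (`Polynomial.wronskian`):

* `rootMultiplicity_wronskian_of_zero`, `rootMultiplicity_wronskian_of_isRoot_prod` — at an affine
  point `s` over `{0, 1, ∞}` (a root of `p · q · (p − q)` of multiplicity `e_s`, the ramification
  index of `p/q` at `s`) the Wronskian vanishes to order EXACTLY `e_s − 1`;
* `natDegree_wronskian_of_natDegree_ne` — if `deg p ≠ deg q` then `deg W = deg p + deg q − 1`
  (`∞ ↦ 0` or `∞`, ramification index `|deg p − deg q|`);
* `natDegree_wronskian_of_natDegree_eq`, `natDegree_wronskian_eq_iff_unramified_infty`,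
  `natDegree_sub_C_mul_eq_iff_coeff` — if `deg p = deg q = d` (`∞ ↦ c = lc p / lc q`, finite and
  non-zero) then `deg W = deg (p − c q) + d − 1`, so `deg W = 2d − 2` iff `p/q` is UNRAMIFIED at `∞`
  iff `deg (p − c q) = d − 1` iff `p_{d−1} q_d ≠ p_d q_{d−1}`.

Together: `Σ_{s affine} (e_s − 1) = deg W` once every root of `W` is special, and `e_∞ − 1 =
(deg p + deg q + deg (p − q)) − d − 1 − deg W`; the three-point Riemann–Hurwitz count built on this
is `BelyiThreePointCount.lean`.  Source formalised: the ramification bookkeeping (3.0.7)–(3.0.13) in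
the proof of W. Goldring, *Unifying themes suggested by Belyi's theorem* (2011), Thm 3.2
[cite: Goldring2011, Thm 3.2] ("equality in Mason–Stothers iff `f/g` is a Belyi map with
`(f/g)(∞) ∈ {0,1,∞}`"), written for the Wronskian instead of the ramification divisor (genus-`0`
Riemann–Hurwitz; cf. the proof of Mathlib's `Polynomial.abc`).  Theorems only, no definitions, no named
facts; the four coprimality helpers are private.
-/

noncomputable section

namespace Literature.NumberTheory.DiophantineGeometry

open Polynomial

variable {K : Type*} [Field K]

/-! ### Coprimality bookkeeping -/

section Coprime

variable {p q : K[X]}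

/-- `p − q` and `q` are coprime when `p` and `q` are. [folklore] -/
private theorem isCoprime_sub_self_left (h : IsCoprime p q) : IsCoprime (p - q) q := by
  obtain ⟨u, v, huv⟩ := h
  exact ⟨u, u + v, by linear_combination huv⟩

/-- `p` and `p − q` are coprime when `p` and `q` are. [folklore] -/
private theorem isCoprime_self_sub_right (h : IsCoprime p q) : IsCoprime p (p - q) := by
  obtain ⟨u, v, huv⟩ := h
  exact ⟨u + v, -v, by linear_combination huv⟩

/-- A common value `p(z) = q(z)` of coprime `p, q` at a root of `q` is impossible: if `q(z) = 0` then
`p(z) ≠ 0`. [folklore] -/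
private theorem eval_ne_zero_of_isCoprime_of_eval_eq_zero (h : IsCoprime p q) {z : K} (hq : q.eval z = 0) :
    p.eval z ≠ 0 := by
  intro hp
  obtain ⟨u, v, huv⟩ := h
  have h1 := congrArg (eval z) huv
  rw [eval_add, eval_mul, eval_mul, hp, hq, mul_zero, mul_zero, add_zero, eval_one] at h1
  exact zero_ne_one h1

/-- The zero set of `p · q · (p − q)`: `z` is a root iff `p(z) = 0 ∨ q(z) = 0 ∨ p(z) = q(z)` — the
affine points of `ℙ¹` over `0`, `∞`, `1` under `p/q`. [folklore] -/
private theorem isRoot_prod_iff (z : K) :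
    (p * q * (p - q)).IsRoot z ↔ p.eval z = 0 ∨ q.eval z = 0 ∨ p.eval z = q.eval z := by
  rw [IsRoot.def, eval_mul, eval_mul, eval_sub, mul_eq_zero, mul_eq_zero, sub_eq_zero, or_assoc]

end Coprime

/-! ### The Wronskian at the special points -/

section Multiplicity

variable {p q : K[X]}

/-- Under the Belyi clause (B) every root of the Wronskian is an affine point over `{0, 1, ∞}`, i.e.
a root of `p · q · (p − q)`. [cite: Goldring2011, Thm 3.2 (proof)] -/
theorem isRoot_prod_of_isRoot_wronskian
    (hcrit : ∀ z : K, q.eval z ≠ 0 → (wronskian p q).eval z = 0 → p.eval z = 0 ∨ p.eval z = q.eval z)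
    {z : K} (hz : (wronskian p q).IsRoot z) : (p * q * (p - q)).IsRoot z := by
  rw [isRoot_prod_iff]
  by_cases hq : q.eval z = 0
  · exact Or.inr (Or.inl hq)
  · rcases hcrit z hq hz with h | h
    · exact Or.inl h
    · exact Or.inr (Or.inr h)

variable [CharZero K]

/-- In characteristic `0` the Wronskian of a coprime pair defining a non-constant map is non-zero.
[cite: Goldring2011, Thm 3.2 (proof)] -/
theorem wronskian_ne_zero_of_isCoprime (hcop : IsCoprime p q) (hd : 0 < max p.natDegree q.natDegree) :
    wronskian p q ≠ 0 := by
  intro hw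
  rw [hcop.wronskian_eq_zero_iff] at hw
  rw [derivative_eq_zero.mp hw.1, derivative_eq_zero.mp hw.2, max_self] at hd
  exact lt_irrefl 0 hd

/-- The multiplicity of a ZERO `x` of `p/q` (a root of `p` of multiplicity `e`, `q(x) ≠ 0`) as a root
of the Wronskian is exactly `e − 1` (characteristic `0`; companion of
`rootMultiplicity_wronskian_of_pole`). [cite: Goldring2011, Thm 3.2 (proof)] -/
theorem rootMultiplicity_wronskian_of_zero (hp : p ≠ 0) {x : K} (hpx : p.IsRoot x)
    (hqx : q.eval x ≠ 0) : (wronskian p q).rootMultiplicity x = p.rootMultiplicity x - 1 := by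
  have he : (p.rootMultiplicity x : K) ≠ 0 :=
    Nat.cast_ne_zero.mpr ((rootMultiplicity_pos hp).mpr hpx).ne'
  rw [← wronskian_neg_eq, rootMultiplicity_neg', rootMultiplicity_wronskian_of_pole hp hqx hpx he]

/-- **Exact ramification at the special points.**  For coprime `p, q` (none of `p, q, p − q` zero) and
a root `s` of `p · q · (p − q)` of multiplicity `e_s`, the Wronskian `p q' − p' q` vanishes at `s` to
order exactly `e_s − 1` (characteristic `0`).  [cite: Goldring2011, Thm 3.2 (proof)] -/
theorem rootMultiplicity_wronskian_of_isRoot_prod (hcop : IsCoprime p q) (hp : p ≠ 0) (hq : q ≠ 0)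
    (hpq : p - q ≠ 0) {s : K} (hs : (p * q * (p - q)).IsRoot s) :
    (wronskian p q).rootMultiplicity s = (p * q * (p - q)).rootMultiplicity s - 1 := by
  have hprod : p * q * (p - q) ≠ 0 := mul_ne_zero (mul_ne_zero hp hq) hpq
  rw [rootMultiplicity_mul hprod, rootMultiplicity_mul (mul_ne_zero hp hq)]
  by_cases hps : p.IsRoot s
  · -- a zero: `q(s) ≠ 0`, `(p - q)(s) ≠ 0`
    rw [rootMultiplicity_eq_zero_of_isCoprime_of_isRoot hcop hps,
      rootMultiplicity_eq_zero_of_isCoprime_of_isRoot (isCoprime_self_sub_right hcop) hps,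
      add_zero, add_zero]
    refine rootMultiplicity_wronskian_of_zero hp hps fun hqs => ?_
    exact eval_ne_zero_of_isCoprime_of_eval_eq_zero hcop hqs hps
  by_cases hqs : q.IsRoot s
  · -- a pole: `p(s) ≠ 0`, `(p - q)(s) ≠ 0`
    rw [rootMultiplicity_eq_zero hps,
      rootMultiplicity_eq_zero_of_isCoprime_of_isRoot (isCoprime_sub_self_left hcop).symm hqs,
      zero_add, add_zero]
    have he : (q.rootMultiplicity s : K) ≠ 0 :=
      Nat.cast_ne_zero.mpr ((rootMultiplicity_pos hq).mpr hqs).ne'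
    exact rootMultiplicity_wronskian_of_pole hq hps hqs he
  · -- a `1`-point: `s` is a root of `p - q`, not of `q`
    rw [rootMultiplicity_eq_zero hps, rootMultiplicity_eq_zero hqs, zero_add, zero_add,
      ← wronskian_sub_self_left]
    have hpqs : (p - q).IsRoot s := by
      rcases (isRoot_prod_iff s).mp hs with h | h | h
      · exact absurd h hps
      · exact absurd h hqs
      · rw [IsRoot.def, eval_sub, h, sub_self]
    exact rootMultiplicity_wronskian_of_zero hpq hpqs hqs

end Multiplicity

/-! ### The degree of the Wronskian (the point at infinity) -/

section Degree

variable [CharZero K] {p q : K[X]}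

/-- If `deg p ≠ deg q` the Wronskian has degree exactly `deg p + deg q − 1`: its coefficient there is
`(deg q − deg p) · lc p · lc q ≠ 0` (`coeff_wronskian_natDegree`).  Geometrically: `p/q` maps `∞` to
`0` or `∞` with ramification index `|deg p − deg q|`. [cite: Goldring2011, Thm 3.2 (proof)] -/
theorem natDegree_wronskian_of_natDegree_ne (hp : p ≠ 0) (hq : q ≠ 0)
    (hne : p.natDegree ≠ q.natDegree) :
    (wronskian p q).natDegree = p.natDegree + q.natDegree - 1 := by
  refine le_antisymm (natDegree_wronskian_le p q) (le_natDegree_of_ne_zero ?_)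
  have hmn : 1 ≤ p.natDegree + q.natDegree := by omega
  rw [coeff_wronskian_natDegree p q hmn]
  refine mul_ne_zero (mul_ne_zero ?_ (leadingCoeff_ne_zero.mpr hp)) (leadingCoeff_ne_zero.mpr hq)
  rw [sub_ne_zero]
  exact_mod_cast hne.symm

omit [CharZero K] in
/-- For coprime `p, q` of the same degree `d ≥ 1` put `c := lc p / lc q = (p/q)(∞)` and
`p₁ := p − c·q`, so that `p/q − c = p₁/q`.  Coprimality gives `p₁ ≠ 0`. [cite: Goldring2011, Thm 3.2 (proof)] -/
theorem sub_C_mul_ne_zero_of_isCoprime {d : ℕ} (hcop : IsCoprime p q) (hq : q.natDegree = d)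
    (hd : 0 < d) (c : K) : p - C c * q ≠ 0 := by
  intro h0
  have hpq : p = C c * q := sub_eq_zero.mp h0
  have hdvd : q ∣ p := ⟨C c, by rw [hpq, mul_comm]⟩
  have hunit : IsUnit q := hcop.symm.isUnit_of_dvd hdvd
  rw [natDegree_eq_zero_of_isUnit hunit] at hq
  omega

omit [CharZero K] in
/-- With `c = lc p / lc q` the top coefficients cancel: `deg (p − c·q) < d`. [cite: Goldring2011, Thm 3.2 (proof)] -/
theorem natDegree_sub_C_mul_lt {d : ℕ} (hp : p.natDegree = d) (hq : q.natDegree = d) (hd : 0 < d) :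
    (p - C (p.leadingCoeff / q.leadingCoeff) * q).natDegree < d := by
  have hq0 : q ≠ 0 := by rintro rfl; rw [natDegree_zero] at hq; omega
  set p₁ := p - C (p.leadingCoeff / q.leadingCoeff) * q with hp₁
  have hle : p₁.natDegree ≤ d := by
    rw [hp₁]
    exact (natDegree_sub_le _ _).trans (max_le hp.le ((natDegree_C_mul_le _ _).trans hq.le))
  have hcoeff : p₁.coeff d = 0 := by
    have hpc : p.coeff d = p.leadingCoeff := by rw [leadingCoeff, hp]
    have hqc : q.coeff d = q.leadingCoeff := by rw [leadingCoeff, hq]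
    rw [hp₁, coeff_sub, coeff_C_mul, hpc, hqc, div_mul_cancel₀ _ (leadingCoeff_ne_zero.mpr hq0),
      sub_self]
  refine lt_of_le_of_ne hle fun h => ?_
  by_cases hp₁0 : p₁ = 0
  · rw [hp₁0, natDegree_zero] at h; omega
  · apply hp₁0
    rw [← leadingCoeff_eq_zero, leadingCoeff, h, hcoeff]

/-- **The Wronskian sees the ramification at `∞`.**  For coprime `p, q` of the same degree `d ≥ 1`
(so `β = p/q` maps `∞` to the finite non-zero value `c = lc p / lc q`):
`deg W(p, q) = deg (p − c·q) + d − 1`, i.e. `2d − 2 − deg W = e_∞ − 1` where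
`e_∞ = d − deg (p − c·q)` is the order of vanishing of `β − β(∞) = (p − c q)/q` at `∞`
(`W(p, q) = W(p − c q, q)` and the degrees `deg (p − c q) < d = deg q` differ). [cite: Goldring2011, Thm 3.2 (proof)] -/
theorem natDegree_wronskian_of_natDegree_eq {d : ℕ} (hcop : IsCoprime p q) (hp : p.natDegree = d)
    (hq : q.natDegree = d) (hd : 0 < d) :
    (wronskian p q).natDegree = (p - C (p.leadingCoeff / q.leadingCoeff) * q).natDegree + d - 1 := by
  have hq0 : q ≠ 0 := by rintro rfl; rw [natDegree_zero] at hq; omega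
  have hlt := natDegree_sub_C_mul_lt hp hq hd
  rw [← wronskian_sub_C_mul_left p q (p.leadingCoeff / q.leadingCoeff),
    natDegree_wronskian_of_natDegree_ne (sub_C_mul_ne_zero_of_isCoprime hcop hq hd _) hq0
      (by rw [hq]; exact hlt.ne), hq]

/-- **Unramified at `∞`.**  For coprime `p, q` of the same degree `d ≥ 1`, the Wronskian has degree
exactly `2d − 2` iff `p − (lc p / lc q)·q` has degree exactly `d − 1`, i.e. iff `β − β(∞)` has a
SIMPLE zero at `∞` (`β = p/q` unramified at `∞`). [cite: Goldring2011, Thm 3.2 (proof)] -/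
theorem natDegree_wronskian_eq_iff_unramified_infty {d : ℕ} (hcop : IsCoprime p q)
    (hp : p.natDegree = d) (hq : q.natDegree = d) (hd : 0 < d) :
    (wronskian p q).natDegree = 2 * d - 2 ↔
      (p - C (p.leadingCoeff / q.leadingCoeff) * q).natDegree = d - 1 := by
  rw [natDegree_wronskian_of_natDegree_eq hcop hp hq hd]
  have := natDegree_sub_C_mul_lt hp hq hd
  omega

omit [CharZero K] in
/-- Unramified at `∞` in COEFFICIENTS: for coprime `p, q` of the same degree `d ≥ 1`,
`deg (p − (lc p / lc q)·q) = d − 1` iff `p_{d−1} · q_d ≠ p_d · q_{d−1}` (the subleading `2 × 2`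
minor of the coefficients does not vanish; it is also the coefficient of `W(p, q)` in degree
`2d − 2` up to sign). [cite: Goldring2011, Thm 3.2 (proof)] -/
theorem natDegree_sub_C_mul_eq_iff_coeff {d : ℕ} (hcop : IsCoprime p q) (hp : p.natDegree = d)
    (hq : q.natDegree = d) (hd : 0 < d) :
    (p - C (p.leadingCoeff / q.leadingCoeff) * q).natDegree = d - 1 ↔
      p.coeff (d - 1) * q.leadingCoeff ≠ p.leadingCoeff * q.coeff (d - 1) := by
  have hq0 : q ≠ 0 := by rintro rfl; rw [natDegree_zero] at hq; omega
  have hlcq : q.leadingCoeff ≠ 0 := leadingCoeff_ne_zero.mpr hq0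
  set p₁ := p - C (p.leadingCoeff / q.leadingCoeff) * q with hp₁
  have hlt : p₁.natDegree < d := natDegree_sub_C_mul_lt hp hq hd
  have hp₁0 : p₁ ≠ 0 := sub_C_mul_ne_zero_of_isCoprime hcop hq hd _
  -- `deg p₁ = d - 1 ↔ p₁.coeff (d - 1) ≠ 0`
  have hiff : p₁.natDegree = d - 1 ↔ p₁.coeff (d - 1) ≠ 0 := by
    constructor
    · intro h
      have hlc : p₁.leadingCoeff ≠ 0 := leadingCoeff_ne_zero.mpr hp₁0
      rwa [leadingCoeff, h] at hlc
    · intro h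
      exact le_antisymm (by omega) (le_natDegree_of_ne_zero h)
  have hc : p₁.coeff (d - 1) =
      p.coeff (d - 1) - p.leadingCoeff / q.leadingCoeff * q.coeff (d - 1) := by
    rw [hp₁, coeff_sub, coeff_C_mul]
  rw [hiff, hc, Ne, Ne, not_iff_not, sub_eq_zero, div_mul_eq_mul_div, eq_div_iff hlcq]

end Degree

end Literature.NumberTheory.DiophantineGeometry
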